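import Mathlib
import HarnessLib
import Literature.Analysis.FluidPDE.TypeIAncientMild

/-!
# Crux `ExtremalSpiralSymmetry` (stmt-NavierStokesRegularity-8215), line `registered`, towards stub 1
# (`stub_scalingRecurrence`): an extremal pair saturates its Type-I bound in the FAR PAST

Support file (theorems only, `--supports stmt-NavierStokesRegularity-8215`; no definitions, no named facts). Lead c2.

The open stub `stub_scalingRecurrence` (Conjecture M, recurrence half) asks that an EXTREMAL pair `(C, u)` — `u` in the
KNSS-gauge Type-I ancient mild class `A_C`, the bound ATTAINED at `(−1, 0)` (`‖u(−1,0)‖ = C > 0`), and `C ≤ C'` whenever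
`A_{C'}` has a nontrivial element — have an exact scaling period modulo a rigid motion. A period forces the hot-spot
times `{t : √(−t) sup|u(t,·)| = C}` to be invariant under `t ↦ c²t`, hence to accumulate at `−∞` (and at `0⁻`). This
file proves, unconditionally, the half of that necessary condition which extremality DOES give:

* `extremal_farPast_saturation` — for every `ε > 0` and every `T < 0` there are `t < T` and `x` with
  `‖u(t, x)‖ > (C − ε)/√(−t)`: the scale-invariant amplitude `√(−t) sup_x ‖u(t,x)‖` has `limsup = C` as `t → −∞`.
  Proof: otherwise the forward time shift `u(· − δ, ·)` (again in the class, `IsTypeIAncientMild.comp_sub_right`;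
  nontrivial at `t = −1 + δ`) obeys the Type-I bound with the STRICTLY smaller constant `max (C − ε) (qC)`,
  `q = √(1 − δ/(−T)) < 1` — far past: the assumed slack `ε`; recent past `t − δ ≥ T`: the gain `√(−t)/√(−t + δ) ≤ q`
  of the shift — contradicting the minimality of `C`.

So any recurrence of an extremal must be looked for in its far past (its blow-DOWN limits along saturating times are
again extremal pairs by the compactness behind `MinimiserExists`); no constraint at `t → 0⁻` follows this way (the
class admits no backward time shifts).
-/

noncomputable section

-- the summit and its single sub-problem share the name (CONVENTIONS §1), as in every Theorems file
set_option linter.dupNamespace false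

open Set MeasureTheory Filter Topology
open Literature.Analysis.FluidPDE

namespace Summit.NavierStokesRegularity.NavierStokesRegularity.Theorems.ExtremalSpiralSymmetry.Registered

/-- **Far-past saturation of an extremal pair.** Let `(C, u)` be extremal (`u ∈ A_C` written out, `‖u(−1,0)‖ = C > 0`,
`C` minimal among the constants of nontrivial elements). Then for every `ε > 0` and `T < 0` some point `(t, x)` with
`t < T` has `‖u(t,x)‖ > (C − ε)/√(−t)`. Otherwise the forward time shift `u(· − δ, ·)`, `0 < δ < min(−T, 1)`, is a
nontrivial element of `A_{C'}` with `C' = max (C − ε) (√(1 − δ/(−T)) C) < C`, against minimality. [folklore] -/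
theorem extremal_farPast_saturation :
    ∀ (C : ℝ) (u : ℝ → EuclideanSpace ℝ (Fin 3) → EuclideanSpace ℝ (Fin 3)), 0 < C →
      (ContDiffOn ℝ (⊤ : ℕ∞) (Function.uncurry u) (Set.Iio 0 ×ˢ Set.univ) ∧
          (∀ t < 0, Literature.Analysis.FluidPDE.VectorCalculus.IsDivFree (u t)) ∧
          (∀ s t : ℝ, s < t → t < 0 → ∀ x, u t x =
            Literature.Analysis.FluidPDE.heatFlow (u s) (t - s) x -
              ∫ τ in Set.Ioo s t, ∫ y,
                Literature.Analysis.FluidPDE.oseenKernel (t - τ) (x - y) (u τ y) (u τ y)) ∧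
          Literature.Analysis.FluidPDE.HasTypeITimeDecay C u) ∧
        ‖u (-1) 0‖ = C ∧
        (∀ (C' : ℝ) (u' : ℝ → EuclideanSpace ℝ (Fin 3) → EuclideanSpace ℝ (Fin 3)),
          (ContDiffOn ℝ (⊤ : ℕ∞) (Function.uncurry u') (Set.Iio 0 ×ˢ Set.univ) ∧
            (∀ t < 0, Literature.Analysis.FluidPDE.VectorCalculus.IsDivFree (u' t)) ∧
            (∀ s t : ℝ, s < t → t < 0 → ∀ x, u' t x =
              Literature.Analysis.FluidPDE.heatFlow (u' s) (t - s) x -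
                ∫ τ in Set.Ioo s t, ∫ y,
                  Literature.Analysis.FluidPDE.oseenKernel (t - τ) (x - y) (u' τ y) (u' τ y)) ∧
            Literature.Analysis.FluidPDE.HasTypeITimeDecay C' u') →
          (∃ t < 0, ∃ x, u' t x ≠ 0) → C ≤ C') →
      ∀ ε : ℝ, 0 < ε → ∀ T : ℝ, T < 0 →
        ∃ t < T, ∃ x : EuclideanSpace ℝ (Fin 3), (C - ε) / Real.sqrt (-t) < ‖u t x‖ := by
  intro C u hC hext ε hε T hT
  obtain ⟨hcls, hnorm, hmin⟩ := hext
  by_contra hcon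
  push Not at hcon
  -- `hcon : ∀ t < T, ∀ x, ‖u t x‖ ≤ (C - ε) / √(-t)`
  have hA : IsTypeIAncientMild C u := isTypeIAncientMild_iff.2 hcls
  -- the slack constant is nonnegative (evaluate at one far-past point)
  have hCε : 0 ≤ C - ε := by
    have h := hcon (T - 1) (by linarith) 0
    have hs : 0 < Real.sqrt (-(T - 1)) := Real.sqrt_pos.2 (by linarith)
    have h' : 0 ≤ (C - ε) / Real.sqrt (-(T - 1)) := (norm_nonneg _).trans h
    by_contra hneg
    push Not at hneg
    have : (C - ε) / Real.sqrt (-(T - 1)) < 0 := div_neg_of_neg_of_pos hneg hs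
    linarith
  -- the shift `δ` and the gain `q`
  set δ : ℝ := min (-T / 2) (1 / 2) with hδdef
  have hδpos : 0 < δ := lt_min (by linarith) (by norm_num)
  have hδT : δ < -T := lt_of_le_of_lt (min_le_left _ _) (by linarith)
  have hδ1 : δ < 1 := lt_of_le_of_lt (min_le_right _ _) (by norm_num)
  set q : ℝ := Real.sqrt (1 - δ / (-T)) with hqdef
  have hT0 : 0 < -T := by linarith
  have hq_arg : 0 < 1 - δ / (-T) := by
    rw [sub_pos, div_lt_one hT0]; exact hδT
  have hq_arg1 : 1 - δ / (-T) < 1 := by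
    have : 0 < δ / (-T) := div_pos hδpos hT0
    linarith
  have hq0 : 0 < q := Real.sqrt_pos.2 hq_arg
  have hq1 : q < 1 := by
    rw [hqdef, Real.sqrt_lt' one_pos, one_pow]
    exact hq_arg1
  -- the new constant
  set C' : ℝ := max (C - ε) (q * C) with hC'def
  have hC'lt : C' < C := max_lt (by linarith) (by nlinarith)
  -- the shifted field and its Type-I bound with constant `C'`
  have hshift : IsTypeIAncientMild C (fun t => u (t - δ)) := hA.comp_sub_right hδpos.le
  have hdecay : HasTypeITimeDecay C' (fun t => u (t - δ)) := by
    intro t ht x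
    have hst : 0 < Real.sqrt (-t) := Real.sqrt_pos.2 (by linarith)
    show ‖u (t - δ) x‖ ≤ C' / Real.sqrt (-t)
    by_cases hfar : t - δ < T
    · -- far past: the assumed slack
      refine (hcon (t - δ) hfar x).trans ?_
      have h1 : (C - ε) / Real.sqrt (-(t - δ)) ≤ (C - ε) / Real.sqrt (-t) :=
        div_le_div_of_nonneg_left hCε hst (Real.sqrt_le_sqrt (by linarith))
      exact h1.trans (div_le_div_of_nonneg_right (le_max_left _ _) hst.le)
    · -- recent past: the gain of the shift
      push Not at hfar
      have hs0 : t - δ < 0 := by linarith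
      refine (hA.norm_le hs0 x).trans ?_
      -- `C / √(δ - t) ≤ q C / √(-t)` since `-t ≤ -T - δ`
      have hsd : 0 < Real.sqrt (-(t - δ)) := Real.sqrt_pos.2 (by linarith)
      have hmt : -t ≤ -T - δ := by linarith
      have hkey : Real.sqrt (-t) ≤ q * Real.sqrt (-(t - δ)) := by
        rw [hqdef, ← Real.sqrt_mul hq_arg.le]
        refine Real.sqrt_le_sqrt ?_
        -- `-t ≤ (1 - δ/(-T)) (δ - t)`
        rw [show -(t - δ) = δ + -t by ring]
        have e : (1 - δ / -T) * (δ + -t) = δ + -t - δ / -T * δ - δ / -T * -t := by ring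
        rw [e]
        have h2 : δ / -T * -t ≤ δ / -T * (-T - δ) :=
          mul_le_mul_of_nonneg_left hmt (div_pos hδpos hT0).le
        have h3 : δ / -T * (-T - δ) = δ - δ / -T * δ := by
          rw [mul_sub, div_mul_cancel₀ _ hT0.ne']
        nlinarith [h2, h3]
      have hle : C / Real.sqrt (-(t - δ)) ≤ q * C / Real.sqrt (-t) := by
        rw [div_le_div_iff₀ hsd hst]
        calc C * Real.sqrt (-t) ≤ C * (q * Real.sqrt (-(t - δ))) :=
              mul_le_mul_of_nonneg_left hkey hC.le
          _ = q * C * Real.sqrt (-(t - δ)) := by ring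
      exact hle.trans (div_le_div_of_nonneg_right (le_max_right _ _) hst.le)
  have hlit := isTypeIAncientMild_iff.1 hshift
  -- nontrivial at `t = -1 + δ`
  have hne : ∃ t < (0 : ℝ), ∃ x, (fun t => u (t - δ)) t x ≠ 0 := by
    refine ⟨-1 + δ, by linarith, 0, ?_⟩
    show u (-1 + δ - δ) 0 ≠ 0
    rw [show (-1 : ℝ) + δ - δ = -1 by ring, ← norm_pos_iff, hnorm]
    exact hC
  -- minimality of `C`
  have hle : C ≤ C' := hmin C' (fun t => u (t - δ)) ⟨hlit.1, hlit.2.1, hlit.2.2.1, hdecay⟩ hne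
  linarith

end Summit.NavierStokesRegularity.NavierStokesRegularity.Theorems.ExtremalSpiralSymmetry.Registered

end
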